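import Summits.ResolutionOfSingularities.ResolutionOfSingularities.Theorems.FrobeniusClosingSteerConstOrderBinaryForm
import Literature.AlgebraicGeometry.Resolution.TaylorOrderBound
import Literature.AlgebraicGeometry.Resolution.DerivativeIdeals
import Literature.Barriers.Schanuel.NesterenkoModularScopeOperatorProofs
import Mathlib.RingTheory.Localization.AtPrime.Basic
import Mathlib.RingTheory.Localization.Ideal
import Mathlib.RingTheory.Ideal.IsPrimary
import HarnessLib

/-!
# Crux `Steer` (stmt-ResolutionOfSingularities-16345), chain W4.1 — hS1b W-PC6a: **a non-square polynomial of degree `≤ n` over a perfect field of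
# characteristic `2` cannot be cleaned into `𝔮^(n+1)`** (A1, step (e6a) of res-L0-w41-strat-2's hS1b PROOF MAP v1.0; pure polynomial algebra; Theses-free, def-free)

OURS (campaign `res-hironaka`, rung L ★L-G4, slot W4.1; seat res-D-lib-2 g10 on res-L0-w41-plan-1 RULINGS 264(d)/284 (2); word W-PC6a `ReducedOrder.PolyCleanBound`
of `…ReducedOrderWords` (strat-2 `S1B/ReducedOrderWords_sketch.lean` fb31e0fd4d0a20c0, tri-1 VERDICT-S1b PASS): this file proves its body binder for binder, so that
`polyCleanBound : ReducedOrder.PolyCleanBound := fun … => sub_sq_not_mem_maximalIdeal_pow …` is a one-liner once the words file (p566435) is in the tree).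
Candidates, not facts; nothing here is a statement of H. Hironaka's manuscript [Hironaka2017] (status: under review). AI-written; AI review is weaker than expert review.

* `exists_pderiv_ne_zero_of_forall_ne_sq` — over a perfect field of characteristic `2`, a non-square polynomial has a non-zero partial derivative (all partials zero ⇒
  all exponents even ⇒ a square: `ConstOrder.forall_dvd_of_forall_pderiv_eq_zero` + `ConstOrder.exists_pow_eq_of_forall_dvd`).
* **`sub_sq_not_mem_maximalIdeal_pow`** — W-PC6a: `g` non-square of total degree `≤ n`, `𝔮` maximal, `S = k[T]_𝔮`: `g − γ² ∉ 𝔪_S^(n+1)` for every `γ ∈ S`. Write `γ = u/v`;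
  then `v²g − u² ∈ 𝔮^(n+1)` (contraction of the `𝔮`-PRIMARY power, `IsLocalization.under_map_of_isPrimary_disjoint`); a partial `∂ = ∂_i` with `∂g ≠ 0` kills squares in
  characteristic `2`, so `v²·∂g = ∂(v²g − u²) ∈ 𝔮^n` (`Res.Derivation.apply_mem_pow_sub_one`), hence `∂g ∈ 𝔮^n` (`𝔮^n` primary, `v ∉ 𝔮`); but `deg ∂g ≤ n − 1`
  (`Literature.Barriers.Schanuel.totalDegree_mul_pderiv_le`) and the Taylor bound `Res.algebraMap_mvPolynomial_not_mem_maximalIdeal_pow` says `∂g ∉ 𝔪_S^n`.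
[cite: CossartPiltant2008, proof of Prop. 4.2 (a)] [folklore]
-/

-- `Summit.<S>.<S>.…` duplicates the summit name by design (single-problem summit).
set_option linter.dupNamespace false

open IsLocalRing MvPolynomial
open Literature.AlgebraicGeometry.Resolution

namespace Summit.ResolutionOfSingularities.ResolutionOfSingularities.Theorems.SwitchingDichotomy.PolyCleanBound

/-- Over a perfect field of characteristic `2`, a polynomial which is not a square has a non-zero partial derivative. [folklore] -/
theorem exists_pderiv_ne_zero_of_forall_ne_sq {k : Type} [Field k] [CharP k 2] [PerfectField k] {σ : Type}
    (g : MvPolynomial σ k) (hg : ∀ q : MvPolynomial σ k, g ≠ q ^ 2) : ∃ i : σ, pderiv i g ≠ 0 := by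
  classical
  haveI : Fact (Nat.Prime 2) := ⟨Nat.prime_two⟩
  haveI : PerfectRing k 2 := PerfectField.toPerfectRing 2
  by_contra h
  push Not at h
  have hdiv := ConstOrder.forall_dvd_of_forall_pderiv_eq_zero 2 h
  obtain ⟨q, hq, -⟩ := ConstOrder.exists_pow_eq_of_forall_dvd 2 hdiv
  exact hg q hq.symm

/-- **W-PC6a · PolyCleanBound.** Over a PERFECT field of characteristic `2`, a NON-SQUARE polynomial `g` of total degree `≤ n` cannot be cleaned into
`𝔮^(n+1)` at any maximal ideal `𝔮`: `g − γ² ∉ 𝔪^(n+1)` in `k[T]_𝔮` for every `γ`. OURS. [cite: CossartPiltant2008, proof of Prop. 4.2 (a)] [folklore] -/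
theorem sub_sq_not_mem_maximalIdeal_pow (k : Type) [Field k] [CharP k 2] [PerfectField k] (σ : Type) [Fintype σ] [DecidableEq σ]
    (𝔮 : Ideal (MvPolynomial σ k)) [𝔮.IsMaximal]
    (S : Type) [CommRing S] [Algebra (MvPolynomial σ k) S] [IsLocalization.AtPrime S 𝔮] [IsLocalRing S]
    (g : MvPolynomial σ k) (n : ℕ) (hg : ∀ q : MvPolynomial σ k, g ≠ q ^ 2) (hdeg : g.totalDegree ≤ n) :
    ∀ γ : S, algebraMap (MvPolynomial σ k) S g - γ ^ 2 ∉ maximalIdeal S ^ (n + 1) := by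
  classical
  intro γ hmem
  haveI hprime : 𝔮.IsPrime := Ideal.IsMaximal.isPrime ‹_›
  -- a non-vanishing partial derivative `∂ := ∂_i`
  obtain ⟨i, hgi⟩ := exists_pderiv_ne_zero_of_forall_ne_sq g hg
  have h2 : (2 : MvPolynomial σ k) = 0 := CharTwo.two_eq_zero
  -- write `γ = u / v`
  obtain ⟨⟨u, v⟩, rfl⟩ := IsLocalization.mk'_surjective 𝔮.primeCompl γ
  have hvq : (v : MvPolynomial σ k) ∉ 𝔮 := v.2
  -- `v²g − u²` maps into `𝔪_S^(n+1)`
  set w : MvPolynomial σ k := (v : MvPolynomial σ k) ^ 2 * g - u ^ 2 with hw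
  have hspec := IsLocalization.mk'_spec S u v
  have hwmap : algebraMap (MvPolynomial σ k) S w =
      (algebraMap (MvPolynomial σ k) S v) ^ 2 * (algebraMap (MvPolynomial σ k) S g - IsLocalization.mk' S u v ^ 2) := by
    rw [hw, map_sub, map_mul, map_pow, map_pow]
    have e : (algebraMap (MvPolynomial σ k) S) ↑u = IsLocalization.mk' S u v * (algebraMap (MvPolynomial σ k) S) ↑v := hspec.symm
    rw [e]; ring
  have hwS : algebraMap (MvPolynomial σ k) S w ∈ maximalIdeal S ^ (n + 1) := by
    rw [hwmap]; exact Ideal.mul_mem_left _ _ hmem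
  -- contraction: `w ∈ 𝔮^(n+1)` (a `𝔮`-primary ideal)
  have hmapq : Ideal.map (algebraMap (MvPolynomial σ k) S) 𝔮 = maximalIdeal S :=
    IsLocalization.AtPrime.map_eq_maximalIdeal 𝔮 S
  have hprim : ∀ m : ℕ, m ≠ 0 → (𝔮 ^ m).IsPrimary := fun m hm =>
    Ideal.isPrimary_of_isMaximal_radical (by rw [Ideal.radical_pow 𝔮 hm, hprime.radical]; exact ‹𝔮.IsMaximal›)
  have hdisj : ∀ m : ℕ, m ≠ 0 → Disjoint (𝔮.primeCompl : Set (MvPolynomial σ k)) (𝔮 ^ m : Ideal (MvPolynomial σ k)) := by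
    intro m hm
    rw [Set.disjoint_left]
    intro x hx hxm
    exact hx (Ideal.pow_le_self hm hxm)
  have hcontract : ∀ m : ℕ, m ≠ 0 → ∀ x : MvPolynomial σ k,
      algebraMap (MvPolynomial σ k) S x ∈ maximalIdeal S ^ m → x ∈ 𝔮 ^ m := by
    intro m hm x hx
    have hunder := IsLocalization.under_map_of_isPrimary_disjoint 𝔮.primeCompl S (hprim m hm) (hdisj m hm)
    rw [← hunder, Ideal.under_def, Ideal.mem_comap, Ideal.map_pow, hmapq]
    exact hx
  have hwq : w ∈ 𝔮 ^ (n + 1) := hcontract (n + 1) (by omega) w hwS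
  -- apply `∂`: `∂ w = v² · ∂ g ∈ 𝔮^n`
  set D : Derivation k (MvPolynomial σ k) (MvPolynomial σ k) := pderiv i with hD
  have hDw : D w = (v : MvPolynomial σ k) ^ 2 * pderiv i g := by
    rw [hw, map_sub, Derivation.leibniz, Derivation.leibniz_pow, Derivation.leibniz_pow]
    simp only [hD, smul_eq_mul, nsmul_eq_mul, Nat.cast_ofNat, h2, zero_mul, mul_zero, add_zero, sub_zero]
  have hDwq : D w ∈ 𝔮 ^ n := by
    have := Derivation.apply_mem_pow_sub_one k D 𝔮 (n + 1) hwq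
    simpa using this
  rw [hDw] at hDwq
  -- `𝔮^n` is primary and `v² ∉ 𝔮 = √(𝔮^n)`, so `∂ g ∈ 𝔮^n`
  rcases Nat.eq_zero_or_pos n with hn0 | hnpos
  · -- `n = 0`: `g` is a constant, and every constant of a perfect field of characteristic `2` is a square
    exfalso
    have hdeg0 : g.totalDegree = 0 := by omega
    have hgC : g = C (coeff 0 g) := totalDegree_eq_zero_iff_eq_C.mp hdeg0
    haveI : Fact (Nat.Prime 2) := ⟨Nat.prime_two⟩
    haveI : PerfectRing k 2 := PerfectField.toPerfectRing 2
    have hroot : ((frobeniusEquiv k 2).symm (coeff 0 g)) ^ 2 = coeff 0 g := by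
      rw [← frobeniusEquiv_def, RingEquiv.apply_symm_apply]
    refine hg (C ((frobeniusEquiv k 2).symm (coeff 0 g))) ?_
    rw [← map_pow, hroot]
    exact hgC
  have hgq : pderiv i g ∈ 𝔮 ^ n := by
    have hp := hprim n (by omega)
    rcases (Ideal.isPrimary_iff.mp hp).2 (by rw [mul_comm] at hDwq; exact hDwq) with h | h
    · exact h
    · exfalso
      rw [Ideal.radical_pow 𝔮 (by omega), hprime.radical] at h
      exact hvq (hprime.mem_of_pow_mem 2 h)
  -- Taylor bound: `∂ g ∉ 𝔪_S^n` since `deg ∂g ≤ n − 1 < n`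
  have hdegD : (pderiv i g).totalDegree < n := by
    have hle := Literature.Barriers.Schanuel.totalDegree_mul_pderiv_le i (1 : MvPolynomial σ k) g
    rw [one_mul, totalDegree_one, zero_add] at hle
    omega
  have hnot := algebraMap_mvPolynomial_not_mem_maximalIdeal_pow 𝔮 S hgi hdegD
  apply hnot
  rw [← hmapq, ← Ideal.map_pow]
  exact Ideal.mem_map_of_mem _ hgq

end Summit.ResolutionOfSingularities.ResolutionOfSingularities.Theorems.SwitchingDichotomy.PolyCleanBound
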